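import Mathlib
import Literature.Analysis.Complex.HolomorphicParametricIntegral
import Literature.MathematicalPhysics.QuantumFieldTheory.OSReconstructionNoE1Proofs

/-!
# `stub_linearity` (crux `PlanarSpectralCone`, line `two-mirror-lightcone-slots`) — candidate proof

drefute gen 4 (refuter-drefute-stmt-QuantumFields-9664-g4-0), evidence for the lead prover.
No `def`, no `local notation`, no `sorry`; imports = Mathlib + two tree modules the skeleton already uses.

* Part A — the Laplace–Fourier transform `z ↦ ∫ e^{−z p₀ + i⟨a,p⟩} dμ` of a finite measure carried by
  `{p₀ ≥ 0}`: holomorphic on `Re z > 0` (`Literature.Analysis.Complex.differentiableOn_integral_of_dominated`),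
  continuous on `Re z ≥ 0` (dominated convergence).
* Part B — **uniqueness** (`measure_ext_of_laplaceFourier`): two finite measures on `ℝ^d` carried by
  `{p₀ ≥ 0}` with the same Laplace–Fourier data `(t ≥ 0, a ⊥ e₀)` are equal — identity theorem on the
  right half-plane from the real points `1 + 1/(n+1)`, continuity to the imaginary axis along `z + 1/(n+1)`,
  `charFun μ ξ = (transform at a = ξ − ξ₀e₀, z = −iξ₀)`, `Measure.ext_of_charFun`.
* Part C — joint spectral measures of an `OSReconstructionNoE1` (any labels, any `d ≥ 1`): uniqueness
  (`jsm_unique`), total mass, the parallelogram law `μ_{ψ+φ} + μ_{ψ−φ} = 2(μ_ψ + μ_φ)` and the scaling law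
  `μ_{cψ} = |c|² μ_ψ` AS MEASURES (`jsm_parallelogram`, `jsm_smul`).
* Part D — `stub_linearity` with the lead's signature verbatim (skeleton sha fe3e5eda): `V = {φ | μ_φ N = 0}`
  (canonical `μ_φ = h.jointSpectralMeasure φ`, a joint spectral measure by `exists_isJointSpectralMeasure_holds`)
  is a submodule (parallelogram inequality `μ_{φ₁+φ₂} N ≤ 2(μ_{φ₁} N + μ_{φ₂} N)`, scaling) and closed
  (`μ_φ N ≤ 2 μ_θ N + 2‖φ − θ‖²`), contains `D`, hence `closure (span D) = ⊤`; uniqueness moves the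
  conclusion from `μ_ψ` to the given `μ`.
-/

noncomputable section

namespace DrefuteG4

open MeasureTheory Complex Set Filter Topology
open scoped InnerProductSpace ComplexConjugate NNReal ENNReal
open Literature.MathematicalPhysics.AQFT Literature.MathematicalPhysics.QuantumFieldTheory

section LaplaceFourier

variable {d : ℕ} [NeZero d]

/-! ## Part A. The Laplace–Fourier kernel `e^{−z p₀ + i⟨a,p⟩}` and its transform -/

theorem norm_lfKernel (z : ℂ) (a p : EuclideanSpace ℝ (Fin d)) :
    ‖cexp (-(z * ((p 0 : ℝ) : ℂ)) + ((⟪a, p⟫_ℝ : ℝ) : ℂ) * I)‖ = Real.exp (-(z.re * p 0)) := by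
  rw [Complex.norm_exp]
  congr 1
  simp

theorem norm_lfKernel_le_one {z : ℂ} (hz : 0 ≤ z.re) (a : EuclideanSpace ℝ (Fin d))
    {p : EuclideanSpace ℝ (Fin d)} (hp : 0 ≤ p 0) :
    ‖cexp (-(z * ((p 0 : ℝ) : ℂ)) + ((⟪a, p⟫_ℝ : ℝ) : ℂ) * I)‖ ≤ 1 := by
  rw [norm_lfKernel, Real.exp_le_one_iff, neg_nonpos]
  exact mul_nonneg hz hp

theorem continuous_lfKernel_momentum (z : ℂ) (a : EuclideanSpace ℝ (Fin d)) :
    Continuous fun p : EuclideanSpace ℝ (Fin d) =>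
      cexp (-(z * ((p 0 : ℝ) : ℂ)) + ((⟪a, p⟫_ℝ : ℝ) : ℂ) * I) := by
  fun_prop

theorem differentiable_lfKernel (a p : EuclideanSpace ℝ (Fin d)) :
    Differentiable ℂ fun z : ℂ => cexp (-(z * ((p 0 : ℝ) : ℂ)) + ((⟪a, p⟫_ℝ : ℝ) : ℂ) * I) := by
  fun_prop

theorem ae_energy_nonneg (μ : Measure (EuclideanSpace ℝ (Fin d))) (hE : μ {p | p 0 < 0} = 0) :
    ∀ᵐ p ∂μ, 0 ≤ p 0 := by
  rw [ae_iff]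
  simpa only [not_le] using hE

theorem re_pos_of_mem_ball {τ₀ τ : ℂ} (hτ : τ ∈ Metric.ball τ₀ τ₀.re) : 0 < τ.re := by
  rw [Metric.mem_ball, dist_eq_norm] at hτ
  have h1 := abs_re_le_norm (τ - τ₀)
  rw [Complex.sub_re] at h1
  have h2 := (abs_lt.1 (h1.trans_lt hτ)).1
  linarith

/-- The Laplace–Fourier transform of a finite measure on `{p₀ ≥ 0}` is holomorphic on `Re z > 0`. -/
theorem differentiableOn_laplaceFourier (μ : Measure (EuclideanSpace ℝ (Fin d))) [IsFiniteMeasure μ]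
    (hE : μ {p | p 0 < 0} = 0) (a : EuclideanSpace ℝ (Fin d)) :
    DifferentiableOn ℂ
      (fun z : ℂ => ∫ p, cexp (-(z * ((p 0 : ℝ) : ℂ)) + ((⟪a, p⟫_ℝ : ℝ) : ℂ) * I) ∂μ)
      {z : ℂ | 0 < z.re} := by
  refine Literature.Analysis.Complex.differentiableOn_integral_of_dominated
    (fun z _ => (continuous_lfKernel_momentum z a).aestronglyMeasurable)
    (Eventually.of_forall fun p => (differentiable_lfKernel a p).differentiableOn)
    fun τ₀ hτ₀ => ?_
  refine ⟨τ₀.re, hτ₀, fun τ hτ => re_pos_of_mem_ball hτ, fun _ => 1, integrable_const _, ?_⟩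
  filter_upwards [ae_energy_nonneg μ hE] with p hp
  intro τ hτ
  exact norm_lfKernel_le_one (re_pos_of_mem_ball hτ).le a hp

/-- The Laplace–Fourier transform of a finite measure on `{p₀ ≥ 0}` is continuous on `Re z ≥ 0`. -/
theorem continuousOn_laplaceFourier (μ : Measure (EuclideanSpace ℝ (Fin d))) [IsFiniteMeasure μ]
    (hE : μ {p | p 0 < 0} = 0) (a : EuclideanSpace ℝ (Fin d)) :
    ContinuousOn
      (fun z : ℂ => ∫ p, cexp (-(z * ((p 0 : ℝ) : ℂ)) + ((⟪a, p⟫_ℝ : ℝ) : ℂ) * I) ∂μ)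
      {z : ℂ | 0 ≤ z.re} := by
  refine continuousOn_of_dominated (fun z _ => (continuous_lfKernel_momentum z a).aestronglyMeasurable)
    (fun z hz => ?_) (integrable_const (1 : ℝ))
    (ae_of_all _ fun p => (differentiable_lfKernel a p).continuous.continuousOn)
  filter_upwards [ae_energy_nonneg μ hE] with p hp using norm_lfKernel_le_one hz a hp

/-- Real points, in the normal form of `IsJointSpectralMeasure.inner_transfer_translate`. -/
theorem laplaceFourier_ofReal (μ : Measure (EuclideanSpace ℝ (Fin d))) (a : EuclideanSpace ℝ (Fin d))
    (t : ℝ) :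
    (∫ p, cexp (-((t : ℂ) * ((p 0 : ℝ) : ℂ)) + ((⟪a, p⟫_ℝ : ℝ) : ℂ) * I) ∂μ) =
      ∫ p, cexp ((((-(t * p 0)) : ℝ) : ℂ) + ((⟪a, p⟫_ℝ : ℝ) : ℂ) * I) ∂μ := by
  refine integral_congr_ae (ae_of_all _ fun p => ?_)
  push_cast
  ring_nf

/-- The characteristic function is a boundary value of the Laplace–Fourier transform:
`charFun μ ξ = ∫ e^{−z p₀ + i⟨a,p⟩} dμ` at `a = ξ − ξ₀e₀`, `z = −iξ₀`. -/
theorem charFun_eq_laplaceFourier (μ : Measure (EuclideanSpace ℝ (Fin d))) (ξ : EuclideanSpace ℝ (Fin d)) :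
    charFun μ ξ = ∫ p, cexp (-((-(((ξ 0 : ℝ) : ℂ) * I)) * ((p 0 : ℝ) : ℂ)) +
      ((⟪ξ - (ξ 0) • EuclideanSpace.single 0 1, p⟫_ℝ : ℝ) : ℂ) * I) ∂μ := by
  rw [charFun_apply]
  refine integral_congr_ae (ae_of_all _ fun p => ?_)
  have hinner : ⟪ξ - (ξ 0) • EuclideanSpace.single (0 : Fin d) (1 : ℝ), p⟫_ℝ = ⟪p, ξ⟫_ℝ - ξ 0 * p 0 := by
    rw [inner_sub_left, inner_smul_left, EuclideanSpace.inner_single_left, real_inner_comm]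
    simp
  simp only [hinner]
  congr 1
  push_cast
  ring

/-! ## Part B. Uniqueness -/

/-- Identity theorem + continuity to the boundary: two Laplace–Fourier transforms that agree at real
`t > 0` agree on the closed right half-plane. -/
theorem laplaceFourier_eq_of_eq_real {μ ν : Measure (EuclideanSpace ℝ (Fin d))} [IsFiniteMeasure μ]
    [IsFiniteMeasure ν] (hEμ : μ {p | p 0 < 0} = 0) (hEν : ν {p | p 0 < 0} = 0)
    (a : EuclideanSpace ℝ (Fin d))
    (hreal : ∀ t : ℝ, 0 < t →
      (∫ p, cexp (-((t : ℂ) * ((p 0 : ℝ) : ℂ)) + ((⟪a, p⟫_ℝ : ℝ) : ℂ) * I) ∂μ) =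
        ∫ p, cexp (-((t : ℂ) * ((p 0 : ℝ) : ℂ)) + ((⟪a, p⟫_ℝ : ℝ) : ℂ) * I) ∂ν)
    {z : ℂ} (hz : 0 ≤ z.re) :
    (∫ p, cexp (-(z * ((p 0 : ℝ) : ℂ)) + ((⟪a, p⟫_ℝ : ℝ) : ℂ) * I) ∂μ) =
      ∫ p, cexp (-(z * ((p 0 : ℝ) : ℂ)) + ((⟪a, p⟫_ℝ : ℝ) : ℂ) * I) ∂ν := by
  set f : ℂ → ℂ := fun z => ∫ p, cexp (-(z * ((p 0 : ℝ) : ℂ)) + ((⟪a, p⟫_ℝ : ℝ) : ℂ) * I) ∂μ with hf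
  set g : ℂ → ℂ := fun z => ∫ p, cexp (-(z * ((p 0 : ℝ) : ℂ)) + ((⟪a, p⟫_ℝ : ℝ) : ℂ) * I) ∂ν with hg
  show f z = g z
  -- Step 1: the open half-plane (identity theorem from the real points `1 + 1/(n+1)`)
  have hU : IsOpen {τ : ℂ | 0 < τ.re} := isOpen_lt continuous_const Complex.continuous_re
  have hUc : IsPreconnected {τ : ℂ | 0 < τ.re} := (convex_halfSpace_re_gt 0).isPreconnected
  have hfa : AnalyticOnNhd ℂ f {τ : ℂ | 0 < τ.re} :=
    (differentiableOn_laplaceFourier μ hEμ a).analyticOnNhd hU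
  have hga : AnalyticOnNhd ℂ g {τ : ℂ | 0 < τ.re} :=
    (differentiableOn_laplaceFourier ν hEν a).analyticOnNhd hU
  have h1 : ((1 : ℝ) : ℂ) ∈ {τ : ℂ | 0 < τ.re} := by simp
  have hfreq : ∃ᶠ w in 𝓝[≠] ((1 : ℝ) : ℂ), f w = g w := by
    set u : ℕ → ℂ := fun n => (((1 + 1 / ((n : ℝ) + 1) : ℝ)) : ℂ) with hu
    have hut : Tendsto u atTop (𝓝[≠] ((1 : ℝ) : ℂ)) := by
      rw [tendsto_nhdsWithin_iff]
      refine ⟨?_, Eventually.of_forall fun n => ?_⟩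
      · have h1 : Tendsto (fun n : ℕ => (1 : ℝ) + 1 / ((n : ℝ) + 1)) atTop (𝓝 (1 + 0)) :=
          (tendsto_const_nhds (x := (1 : ℝ)) (f := (atTop : Filter ℕ))).add
            tendsto_one_div_add_atTop_nhds_zero_nat
        rw [add_zero] at h1
        exact (Complex.continuous_ofReal.tendsto 1).comp h1
      · simp only [hu, Set.mem_compl_iff, Set.mem_singleton_iff, Complex.ofReal_inj]
        have : 0 < 1 / ((n : ℝ) + 1) := by positivity
        linarith
    have hall : ∀ n, f (u n) = g (u n) := by
      intro n
      have hpos : 0 < (1 : ℝ) + 1 / ((n : ℝ) + 1) := by positivity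
      exact hreal _ hpos
    exact hut.frequently (Frequently.of_forall hall)
  have hopen : EqOn f g {τ : ℂ | 0 < τ.re} :=
    hfa.eqOn_of_preconnected_of_frequently_eq hga hUc h1 hfreq
  -- Step 2: the boundary, by continuity on the closed half-plane along `z + 1/(n+1)`
  set u : ℕ → ℂ := fun n => z + (((1 / ((n : ℝ) + 1) : ℝ)) : ℂ) with hu
  have hu_mem : ∀ n, u n ∈ {τ : ℂ | 0 < τ.re} := by
    intro n
    have : 0 < 1 / ((n : ℝ) + 1) := by positivity
    simp only [hu, Set.mem_setOf_eq, Complex.add_re, Complex.ofReal_re]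
    linarith
  have hu_t : Tendsto u atTop (𝓝 z) := by
    have h0 : Tendsto (fun n : ℕ => (((1 / ((n : ℝ) + 1) : ℝ)) : ℂ)) atTop (𝓝 ((0 : ℝ) : ℂ)) :=
      (Complex.continuous_ofReal.tendsto 0).comp tendsto_one_div_add_atTop_nhds_zero_nat
    have := (tendsto_const_nhds (x := z) (f := (atTop : Filter ℕ))).add h0
    rw [Complex.ofReal_zero, add_zero] at this
    exact this
  have hu_tw : Tendsto u atTop (𝓝[{τ : ℂ | 0 ≤ τ.re}] z) :=
    tendsto_nhdsWithin_iff.2 ⟨hu_t, Eventually.of_forall fun n =>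
      show 0 ≤ (u n).re from le_of_lt (hu_mem n)⟩
  have hfc := (continuousOn_laplaceFourier μ hEμ a z hz).tendsto.comp hu_tw
  have hgc := (continuousOn_laplaceFourier ν hEν a z hz).tendsto.comp hu_tw
  have heq : f ∘ u = g ∘ u := funext fun n => hopen (hu_mem n)
  rw [heq] at hfc
  exact tendsto_nhds_unique hfc hgc

/-- **Uniqueness of the Laplace–Fourier representation on the half-space.** Two finite measures on
energy–momentum space `ℝ^d` carried by `{p₀ ≥ 0}` with the same data
`∫ e^{−t p₀ + i⟨a,p⟩}` for all `t ≥ 0` and all spatial `a` (`a⁰ = 0`) are equal. -/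
theorem measure_ext_of_laplaceFourier {μ ν : Measure (EuclideanSpace ℝ (Fin d))} [IsFiniteMeasure μ]
    [IsFiniteMeasure ν] (hEμ : μ {p | p 0 < 0} = 0) (hEν : ν {p | p 0 < 0} = 0)
    (hLF : ∀ t : ℝ, 0 ≤ t → ∀ a : EuclideanSpace ℝ (Fin d), a 0 = 0 →
      ∫ p, cexp ((((-(t * p 0)) : ℝ) : ℂ) + ((⟪a, p⟫_ℝ : ℝ) : ℂ) * I) ∂μ =
        ∫ p, cexp ((((-(t * p 0)) : ℝ) : ℂ) + ((⟪a, p⟫_ℝ : ℝ) : ℂ) * I) ∂ν) :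
    μ = ν := by
  refine Measure.ext_of_charFun (funext fun ξ => ?_)
  set a : EuclideanSpace ℝ (Fin d) := ξ - (ξ 0) • EuclideanSpace.single 0 1 with ha
  have ha0 : a 0 = 0 := by simp [ha]
  rw [charFun_eq_laplaceFourier μ ξ, charFun_eq_laplaceFourier ν ξ]
  refine laplaceFourier_eq_of_eq_real hEμ hEν a (fun t ht => ?_) (by simp)
  rw [laplaceFourier_ofReal, laplaceFourier_ofReal]
  exact hLF t ht.le a ha0

end LaplaceFourier

/-! ## Part C. Joint spectral measures: uniqueness, parallelogram law, scaling -/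

section OS

variable {ι : Type*} {d : ℕ} [NeZero d] {S : LabelledSchwingerFamily ι (EuclideanSpace ℝ (Fin d))}
  (h : OSReconstructionNoE1 S)

theorem norm_jsmKernel (t : ℝ) (a p : EuclideanSpace ℝ (Fin d)) :
    ‖cexp ((((-(t * p 0)) : ℝ) : ℂ) + ((⟪a, p⟫_ℝ : ℝ) : ℂ) * I)‖ = Real.exp (-(t * p 0)) := by
  rw [Complex.norm_exp]
  congr 1
  simp

/-- The Laplace–Fourier kernel is integrable against a joint spectral measure (`t ≥ 0`). -/
theorem jsm_integrable {ψ : h.Hilbert} {μ : Measure (EuclideanSpace ℝ (Fin d))}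
    (hμ : h.IsJointSpectralMeasure ψ μ) {t : ℝ} (ht : 0 ≤ t) (a : EuclideanSpace ℝ (Fin d)) :
    Integrable (fun p : EuclideanSpace ℝ (Fin d) =>
      cexp ((((-(t * p 0)) : ℝ) : ℂ) + ((⟪a, p⟫_ℝ : ℝ) : ℂ) * I)) μ := by
  haveI := hμ.isFiniteMeasure
  refine Integrable.mono' (integrable_const (1 : ℝ))
    (by fun_prop : Continuous fun p : EuclideanSpace ℝ (Fin d) =>
      cexp ((((-(t * p 0)) : ℝ) : ℂ) + ((⟪a, p⟫_ℝ : ℝ) : ℂ) * I)).aestronglyMeasurable ?_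
  filter_upwards [ae_energy_nonneg μ hμ.energy_nonneg] with p hp
  rw [norm_jsmKernel, Real.exp_le_one_iff, neg_nonpos]
  exact mul_nonneg ht hp

/-- **Uniqueness of joint spectral measures** (Laplace–Fourier uniqueness on `{p₀ ≥ 0}`). -/
theorem jsm_unique {ψ : h.Hilbert} {μ ν : Measure (EuclideanSpace ℝ (Fin d))}
    (hμ : h.IsJointSpectralMeasure ψ μ) (hν : h.IsJointSpectralMeasure ψ ν) : μ = ν := by
  haveI := hμ.isFiniteMeasure
  haveI := hν.isFiniteMeasure
  exact measure_ext_of_laplaceFourier hμ.energy_nonneg hν.energy_nonneg fun t ht a ha => by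
    rw [← hμ.inner_transfer_translate t ht a ha, ← hν.inner_transfer_translate t ht a ha]

/-- Total mass `μ_ψ(ℝ^d) = ‖ψ‖²` in `ℝ≥0∞` form. -/
theorem jsm_univ {ψ : h.Hilbert} {μ : Measure (EuclideanSpace ℝ (Fin d))}
    (hμ : h.IsJointSpectralMeasure ψ μ) : μ univ = ENNReal.ofReal (‖ψ‖ ^ 2) := by
  haveI := hμ.isFiniteMeasure
  rw [← hμ.measureReal_univ, measureReal_def, ENNReal.ofReal_toReal (measure_ne_top _ _)]

/-- **Parallelogram law as measures**: `μ_{ψ+φ} + μ_{ψ−φ} = 2(μ_ψ + μ_φ)`. -/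
theorem jsm_parallelogram {ψ φ : h.Hilbert} {μa μs μψ μφ : Measure (EuclideanSpace ℝ (Fin d))}
    (ha : h.IsJointSpectralMeasure (ψ + φ) μa) (hs : h.IsJointSpectralMeasure (ψ - φ) μs)
    (hψ : h.IsJointSpectralMeasure ψ μψ) (hφ : h.IsJointSpectralMeasure φ μφ) :
    μa + μs = (2 : ℝ≥0) • (μψ + μφ) := by
  haveI := ha.isFiniteMeasure
  haveI := hs.isFiniteMeasure
  haveI := hψ.isFiniteMeasure
  haveI := hφ.isFiniteMeasure
  refine measure_ext_of_laplaceFourier ?_ ?_ fun t ht a ha0 => ?_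
  · simp [Measure.add_apply, ha.energy_nonneg, hs.energy_nonneg]
  · simp [Measure.smul_apply, Measure.add_apply, hψ.energy_nonneg, hφ.energy_nonneg]
  · rw [integral_add_measure (jsm_integrable h ha ht a) (jsm_integrable h hs ht a),
      integral_smul_nnreal_measure,
      integral_add_measure (jsm_integrable h hψ ht a) (jsm_integrable h hφ ht a),
      ← ha.inner_transfer_translate t ht a ha0, ← hs.inner_transfer_translate t ht a ha0,
      ← hψ.inner_transfer_translate t ht a ha0, ← hφ.inner_transfer_translate t ht a ha0]
    simp only [map_add, map_sub, inner_add_left, inner_add_right, inner_sub_left, inner_sub_right]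
    rw [NNReal.smul_def, Complex.real_smul]
    push_cast
    ring

/-- **Scaling law as measures**: `μ_{cψ} = |c|² μ_ψ`. -/
theorem jsm_smul {ψ : h.Hilbert} (c : ℂ) {μc μψ : Measure (EuclideanSpace ℝ (Fin d))}
    (hc : h.IsJointSpectralMeasure (c • ψ) μc) (hψ : h.IsJointSpectralMeasure ψ μψ) :
    μc = (‖c‖₊ ^ 2 : ℝ≥0) • μψ := by
  haveI := hc.isFiniteMeasure
  haveI := hψ.isFiniteMeasure
  refine measure_ext_of_laplaceFourier hc.energy_nonneg ?_ fun t ht a ha0 => ?_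
  · simp [Measure.smul_apply, hψ.energy_nonneg]
  · rw [integral_smul_nnreal_measure, ← hc.inner_transfer_translate t ht a ha0,
      ← hψ.inner_transfer_translate t ht a ha0]
    simp only [map_smul, inner_smul_left, inner_smul_right]
    rw [NNReal.smul_def, Complex.real_smul, ← mul_assoc]
    congr 1
    push_cast
    rw [mul_comm]
    exact Complex.conj_mul' c

end OS

/-! ## Part D. The stub -/

set_option linter.unusedVariables false in
/-- **CLOSURE / LINEARITY — null sets of joint spectral measures pass to the closed span.** For ANY
labelled family with E2 and translation invariance on `⁰𝒮` (any labels, any dimension), a Borel set `N` of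
energy–momentum space that is null for every joint spectral measure of every vector of a set `D` of dense
linear span is null for every joint spectral measure of every vector. (Signature verbatim from the lead's
skeleton, sha fe3e5eda; `hN` is not needed by the proof.) -/
theorem stub_linearity {ι : Type*} {d : ℕ} [NeZero d]
    {S : LabelledSchwingerFamily ι (EuclideanSpace ℝ (Fin d))} (h : OSReconstructionNoE1 S)
    {N : Set (EuclideanSpace ℝ (Fin d))} (hN : MeasurableSet N) {D : Set h.Hilbert}
    (hD : Dense ((Submodule.span ℂ D : Submodule ℂ h.Hilbert) : Set h.Hilbert))
    (hDN : ∀ ψ ∈ D, ∀ μ : Measure (EuclideanSpace ℝ (Fin d)), h.IsJointSpectralMeasure ψ μ → μ N = 0)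
    (ψ : h.Hilbert) (μ : Measure (EuclideanSpace ℝ (Fin d))) (hμ : h.IsJointSpectralMeasure ψ μ) :
    μ N = 0 := by
  classical
  -- canonical joint spectral measures (existence is the tree theorem `exists_isJointSpectralMeasure_holds`)
  set μv : h.Hilbert → Measure (EuclideanSpace ℝ (Fin d)) := fun φ => h.jointSpectralMeasure φ with hμv_def
  have hμv : ∀ φ : h.Hilbert, h.IsJointSpectralMeasure φ (μv φ) := fun φ =>
    h.isJointSpectralMeasure_jointSpectralMeasure
      (OSReconstructionNoE1.exists_isJointSpectralMeasure_holds h φ)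
  -- parallelogram inequality, scaling, zero
  have hpar : ∀ φ₁ φ₂ : h.Hilbert, μv (φ₁ + φ₂) N ≤ 2 * (μv φ₁ N + μv φ₂ N) := by
    intro φ₁ φ₂
    have e := jsm_parallelogram h (hμv (φ₁ + φ₂)) (hμv (φ₁ - φ₂)) (hμv φ₁) (hμv φ₂)
    calc μv (φ₁ + φ₂) N ≤ (μv (φ₁ + φ₂) + μv (φ₁ - φ₂)) N := by
          rw [Measure.add_apply]; exact le_self_add
      _ = ((2 : ℝ≥0) • (μv φ₁ + μv φ₂)) N := by rw [e]
      _ = 2 * (μv φ₁ N + μv φ₂ N) := by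
          rw [Measure.smul_apply, Measure.add_apply, ENNReal.smul_def, smul_eq_mul]
          norm_num
  have hsmul : ∀ (c : ℂ) (φ : h.Hilbert), μv (c • φ) N = (‖c‖₊ ^ 2 : ℝ≥0) • μv φ N := by
    intro c φ
    have e := jsm_smul h c (hμv (c • φ)) (hμv φ)
    rw [e, Measure.smul_apply]
  have hzero : μv 0 N = 0 := by
    have e := hsmul 0 0
    rw [smul_zero] at e
    rw [e]
    simp
  -- the subspace `V = {φ | μ_φ N = 0}`
  let V : Submodule ℂ h.Hilbert :=
    { carrier := {φ | μv φ N = 0}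
      add_mem' := fun {φ₁ φ₂} h₁ h₂ => by
        simp only [Set.mem_setOf_eq] at h₁ h₂ ⊢
        refine le_antisymm ?_ bot_le
        calc μv (φ₁ + φ₂) N ≤ 2 * (μv φ₁ N + μv φ₂ N) := hpar φ₁ φ₂
          _ = 0 := by rw [h₁, h₂]; simp
      zero_mem' := hzero
      smul_mem' := fun c φ hφ => by
        simp only [Set.mem_setOf_eq] at hφ ⊢
        rw [hsmul, hφ, smul_zero] }
  -- `V` is closed: `μ_φ N ≤ 2 μ_θ N + 2 μ_{φ−θ} N ≤ 2‖φ − θ‖²` for `θ ∈ V` close to `φ`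
  have hVc : IsClosed (V : Set h.Hilbert) := by
    refine isClosed_of_closure_subset fun φ hφ => ?_
    show μv φ N = 0
    refine le_antisymm (ENNReal.le_of_forall_pos_le_add fun ε hε _ => ?_) bot_le
    rw [zero_add]
    have hδ : (0 : ℝ) < min 1 ((ε : ℝ) / 2) := by
      have : (0 : ℝ) < ε := by exact_mod_cast hε
      positivity
    obtain ⟨θ, hθV, hθ⟩ := Metric.mem_closure_iff.1 hφ (min 1 ((ε : ℝ) / 2)) hδ
    have hθ0 : μv θ N = 0 := hθV
    rw [dist_eq_norm] at hθ
    have hr : 2 * ‖φ - θ‖ ^ 2 ≤ (ε : ℝ) := by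
      have h1 : ‖φ - θ‖ < 1 := lt_of_lt_of_le hθ (min_le_left _ _)
      have h2 : ‖φ - θ‖ < (ε : ℝ) / 2 := lt_of_lt_of_le hθ (min_le_right _ _)
      have h0 : 0 ≤ ‖φ - θ‖ := norm_nonneg _
      nlinarith
    calc μv φ N = μv (θ + (φ - θ)) N := by rw [add_sub_cancel]
      _ ≤ 2 * (μv θ N + μv (φ - θ) N) := hpar θ (φ - θ)
      _ = 2 * μv (φ - θ) N := by rw [hθ0, zero_add]
      _ ≤ 2 * μv (φ - θ) univ := by gcongr; exact subset_univ _
      _ = 2 * ENNReal.ofReal (‖φ - θ‖ ^ 2) := by rw [jsm_univ h (hμv _)]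
      _ = ENNReal.ofReal (2 * ‖φ - θ‖ ^ 2) := by
          rw [ENNReal.ofReal_mul (by norm_num : (0 : ℝ) ≤ 2)]; norm_num
      _ ≤ ENNReal.ofReal (ε : ℝ) := ENNReal.ofReal_le_ofReal hr
      _ = ε := ENNReal.ofReal_coe_nnreal
  -- `D ⊆ V`, hence `closure (span D) ⊆ V`, hence `ψ ∈ V`
  have hDV : D ⊆ (V : Set h.Hilbert) := fun φ hφ => hDN φ hφ (μv φ) (hμv φ)
  have hspan : ((Submodule.span ℂ D : Submodule ℂ h.Hilbert) : Set h.Hilbert) ⊆ V :=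
    Submodule.span_le.2 hDV
  have hcl : closure ((Submodule.span ℂ D : Submodule ℂ h.Hilbert) : Set h.Hilbert) ⊆ V :=
    closure_minimal hspan hVc
  have hψV : μv ψ N = 0 := hcl (hD ψ)
  rwa [jsm_unique h hμ (hμv ψ)]

end DrefuteG4
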